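import Mathlib

/-!
# Renewal sequences: `Σₖ fₖ ≤ 1`, and `Σₖ fₖ = 1` when `Σₙ uₙ = ∞` (Feller, Vol. I, XIII.3)

Topic `Literature/Probability/Process`.  Source: W. Feller, *An Introduction to Probability Theory and Its
Applications*, Vol. I, 3rd ed. (1968), Chapter XIII (Recurrent events), §3, eqs. (3.1)–(3.2) and Theorem 2:
the renewal equation `uₙ = f₁ uₙ₋₁ + f₂ uₙ₋₂ + ⋯ + fₙ u₀` (`n ≥ 1`, `u₀ = 1`) is equivalent to the generating
function identity `U(s) = 1/(1 − F(s))` (`0 ≤ s < 1`), and "the recurrent event is persistent (`Σ fₖ = 1`) if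
and only if `Σ uₙ = ∞`".  We record the direction used by Kesten's irreducible-bridge identity (Kesten 1963, §4;
Madras–Slade 1993, (4.2.2)–(4.2.4)): for NONNEGATIVE sequences `u, f` with `u₀ = 1`, `f₀ = 0`, `uₙ ≤ 1` and the
renewal equation,

* `Renewal.f_le_u` — `fₙ ≤ uₙ`;
* `Renewal.genFun_identity` — `U(s) = 1 + F(s) U(s)` for `0 ≤ s < 1`, with `U(s) = Σ uₙ sⁿ`, `F(s) = Σ fₖ sᵏ` written out as `tsum`s;
* `Renewal.sum_range_f_le_one`, `Renewal.summable_f`, `Renewal.tsum_f_le_one` — `Σₖ fₖ ≤ 1`;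
* **`Renewal.hasSum_f_one`** — if `Σₙ uₙ = ∞` (`¬ Summable u`) then `Σₖ fₖ = 1`;
* **`Renewal.not_summable_mul_of_tendsto_zero`** — null recurrence: if `Σₖ fₖ = 1` and `uₙ → 0` then `Σₖ k fₖ = ∞`
  (`1 - F(s) ≤ (1-s) μ` by Bernoulli gives `(1-s)U(s) ≥ 1/μ`, while `uₙ → 0` gives `(1-s)U(s) → 0`; Feller XIII.4).

(The boundedness `uₙ ≤ 1` replaces Feller's standing assumption that `f` is a probability distribution; it
holds for the bridge partition functions `B_T(x_c) ≤ 1` of Duminil-Copin–Smirnov.)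
-/

noncomputable section

open Finset Filter Topology

namespace Literature.Probability.Process.Renewal

variable {u f : ℕ → ℝ}

/-- `fₙ ≤ uₙ` (the term `k = n` of the renewal equation, `u₀ = 1`). [cite: Feller1968, XIII.3] -/
theorem f_le_u (hu0 : u 0 = 1) (hu : ∀ n, 0 ≤ u n) (hf : ∀ k, 0 ≤ f k) (hf0 : f 0 = 0)
    (hren : ∀ n, 1 ≤ n → u n = ∑ k ∈ range (n + 1), f k * u (n - k)) (n : ℕ) : f n ≤ u n := by
  rcases Nat.eq_zero_or_pos n with rfl | hn
  · rw [hf0, hu0]; norm_num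
  · rw [hren n hn]
    have hmem : n ∈ range (n + 1) := by simp
    have := single_le_sum (f := fun k => f k * u (n - k)) (fun k _ => mul_nonneg (hf k) (hu _)) hmem
    simpa [hu0] using this

/-- A nonnegative sequence bounded by `1` has a summable generating function on `[0,1)`. [folklore] -/
theorem summable_mul_pow {v : ℕ → ℝ} (hv : ∀ n, 0 ≤ v n) (hv1 : ∀ n, v n ≤ 1) {s : ℝ} (hs0 : 0 ≤ s)
    (hs1 : s < 1) : Summable fun n => v n * s ^ n := by
  refine Summable.of_nonneg_of_le (fun n => mul_nonneg (hv n) (pow_nonneg hs0 n)) (fun n => ?_)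
    (summable_geometric_of_lt_one hs0 hs1)
  exact mul_le_of_le_one_left (pow_nonneg hs0 n) (hv1 n)

/-- For a nonnegative real sequence, summability of norms is summability. [folklore] -/
theorem summable_norm_of_nonneg {v : ℕ → ℝ} (hv : ∀ n, 0 ≤ v n) (h : Summable v) :
    Summable fun n => ‖v n‖ := by
  simpa [Real.norm_eq_abs, abs_of_nonneg (hv _)] using h

/-- **The generating-function form of the renewal equation**: `U(s) = 1 + F(s) U(s)` for `0 ≤ s < 1`.
[cite: Feller1968, XIII.3 (3.2)] -/
theorem genFun_identity (hu0 : u 0 = 1) (hu : ∀ n, 0 ≤ u n) (hu1 : ∀ n, u n ≤ 1) (hf : ∀ k, 0 ≤ f k)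
    (hf0 : f 0 = 0) (hren : ∀ n, 1 ≤ n → u n = ∑ k ∈ range (n + 1), f k * u (n - k))
    {s : ℝ} (hs0 : 0 ≤ s) (hs1 : s < 1) :
    (∑' n, u n * s ^ n) = 1 + (∑' k, f k * s ^ k) * (∑' n, u n * s ^ n) := by
  have hfu : ∀ n, f n ≤ u n := f_le_u hu0 hu hf hf0 hren
  have hf1 : ∀ n, f n ≤ 1 := fun n => (hfu n).trans (hu1 n)
  have hU : Summable fun n => u n * s ^ n := summable_mul_pow hu hu1 hs0 hs1
  have hF : Summable fun n => f n * s ^ n := summable_mul_pow hf hf1 hs0 hs1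
  have hUn : Summable fun n => ‖u n * s ^ n‖ :=
    summable_norm_of_nonneg (fun n => mul_nonneg (hu n) (pow_nonneg hs0 n)) hU
  have hFn : Summable fun n => ‖f n * s ^ n‖ :=
    summable_norm_of_nonneg (fun n => mul_nonneg (hf n) (pow_nonneg hs0 n)) hF
  -- Cauchy product
  have hprod : (∑' k, f k * s ^ k) * (∑' n, u n * s ^ n) =
      ∑' n, ∑ k ∈ range (n + 1), (f k * s ^ k) * (u (n - k) * s ^ (n - k)) :=
    tsum_mul_tsum_eq_tsum_sum_range_of_summable_norm hFn hUn
  -- the `n`-th coefficient of the product is `uₙ sⁿ` for `n ≥ 1` and `0` for `n = 0`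
  set g : ℕ → ℝ := fun n => ∑ k ∈ range (n + 1), (f k * s ^ k) * (u (n - k) * s ^ (n - k)) with hg
  have hg_eq : ∀ n, g n = s ^ n * ∑ k ∈ range (n + 1), f k * u (n - k) := by
    intro n
    rw [hg, mul_sum]
    refine sum_congr rfl fun k hk => ?_
    have hk' : k ≤ n := Nat.lt_succ_iff.mp (mem_range.mp hk)
    have : s ^ n = s ^ k * s ^ (n - k) := by rw [← pow_add, Nat.add_sub_cancel' hk']
    rw [this]; ring
  have hg0 : g 0 = 0 := by simp [hg_eq, hf0]
  have hgS : ∀ n, g (n + 1) = u (n + 1) * s ^ (n + 1) := by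
    intro n
    rw [hg_eq, ← hren (n + 1) (Nat.succ_le_succ (Nat.zero_le _)), mul_comm]
  have hgsum : Summable g := by
    have : Summable fun n => u (n + 1) * s ^ (n + 1) := (summable_nat_add_iff 1).mpr hU
    refine (summable_nat_add_iff 1).mp ?_
    simpa [hgS] using this
  have h1 : ∑' n, g n = ∑' n, u (n + 1) * s ^ (n + 1) := by
    rw [hgsum.tsum_eq_zero_add, hg0, zero_add]
    exact tsum_congr hgS
  have h2 : (∑' n, u n * s ^ n) = 1 + ∑' n, u (n + 1) * s ^ (n + 1) := by
    rw [hU.tsum_eq_zero_add]; simp [hu0]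
  rw [hprod, h1, h2]

/-- `U(s) ≥ 1` for `0 ≤ s < 1`. [cite: Feller1968, XIII.3] -/
theorem one_le_genU (hu0 : u 0 = 1) (hu : ∀ n, 0 ≤ u n) (hu1 : ∀ n, u n ≤ 1) {s : ℝ} (hs0 : 0 ≤ s)
    (hs1 : s < 1) : 1 ≤ (∑' n, u n * s ^ n) := by
  have hU : Summable fun n => u n * s ^ n := summable_mul_pow hu hu1 hs0 hs1
  have := hU.sum_le_tsum (range 1) (fun n _ => mul_nonneg (hu n) (pow_nonneg hs0 n))
  simpa [hu0] using this

/-- `F(s) < 1` and `U(s) (1 − F(s)) = 1` for `0 ≤ s < 1`. [cite: Feller1968, XIII.3 (3.2)] -/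
theorem genF_lt_one (hu0 : u 0 = 1) (hu : ∀ n, 0 ≤ u n) (hu1 : ∀ n, u n ≤ 1) (hf : ∀ k, 0 ≤ f k)
    (hf0 : f 0 = 0) (hren : ∀ n, 1 ≤ n → u n = ∑ k ∈ range (n + 1), f k * u (n - k))
    {s : ℝ} (hs0 : 0 ≤ s) (hs1 : s < 1) :
    (∑' k, f k * s ^ k) < 1 ∧ (∑' n, u n * s ^ n) * (1 - (∑' k, f k * s ^ k)) = 1 := by
  have hid := genFun_identity hu0 hu hu1 hf hf0 hren hs0 hs1
  have hU1 := one_le_genU hu0 hu hu1 hs0 hs1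
  have hkey : (∑' n, u n * s ^ n) * (1 - (∑' k, f k * s ^ k)) = 1 := by linear_combination hid
  refine ⟨?_, hkey⟩
  by_contra h
  rw [not_lt] at h
  have : (∑' n, u n * s ^ n) * (1 - (∑' k, f k * s ^ k)) ≤ 0 :=
    mul_nonpos_of_nonneg_of_nonpos (by linarith) (by linarith)
  linarith

/-- The partial sums of `f` are at most `1`. [cite: Feller1968, XIII.3, Theorem 2] -/
theorem sum_range_f_le_one (hu0 : u 0 = 1) (hu : ∀ n, 0 ≤ u n) (hu1 : ∀ n, u n ≤ 1) (hf : ∀ k, 0 ≤ f k)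
    (hf0 : f 0 = 0) (hren : ∀ n, 1 ≤ n → u n = ∑ k ∈ range (n + 1), f k * u (n - k)) (N : ℕ) :
    ∑ k ∈ range N, f k ≤ 1 := by
  have hfu : ∀ n, f n ≤ u n := f_le_u hu0 hu hf hf0 hren
  have hf1 : ∀ n, f n ≤ 1 := fun n => (hfu n).trans (hu1 n)
  -- the polynomial `s ↦ Σ_{k<N} f_k s^k` tends to `Σ_{k<N} f_k` as `s → 1⁻` and is `< 1` on `[0,1)`
  have hcont : Tendsto (fun s : ℝ => ∑ k ∈ range N, f k * s ^ k) (𝓝[<] 1) (𝓝 (∑ k ∈ range N, f k)) := by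
    have : Continuous fun s : ℝ => ∑ k ∈ range N, f k * s ^ k := by fun_prop
    simpa using (this.tendsto 1).mono_left nhdsWithin_le_nhds
  refine le_of_tendsto hcont ?_
  have hmem : Set.Ioo (0 : ℝ) 1 ∈ 𝓝[<] (1 : ℝ) := Ioo_mem_nhdsLT (by norm_num)
  filter_upwards [hmem] with s hs
  have hF : Summable fun n => f n * s ^ n := summable_mul_pow hf hf1 hs.1.le hs.2
  have h1 : ∑ k ∈ range N, f k * s ^ k ≤ (∑' k, f k * s ^ k) :=
    hF.sum_le_tsum (range N) (fun n _ => mul_nonneg (hf n) (pow_nonneg hs.1.le n))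
  exact h1.trans (genF_lt_one hu0 hu hu1 hf hf0 hren hs.1.le hs.2).1.le

/-- `f` is summable. [cite: Feller1968, XIII.3, Theorem 2] -/
theorem summable_f (hu0 : u 0 = 1) (hu : ∀ n, 0 ≤ u n) (hu1 : ∀ n, u n ≤ 1) (hf : ∀ k, 0 ≤ f k)
    (hf0 : f 0 = 0) (hren : ∀ n, 1 ≤ n → u n = ∑ k ∈ range (n + 1), f k * u (n - k)) : Summable f :=
  summable_of_sum_range_le hf (sum_range_f_le_one hu0 hu hu1 hf hf0 hren)

/-- `Σₖ fₖ ≤ 1`. [cite: Feller1968, XIII.3, Theorem 2] -/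
theorem tsum_f_le_one (hu0 : u 0 = 1) (hu : ∀ n, 0 ≤ u n) (hu1 : ∀ n, u n ≤ 1) (hf : ∀ k, 0 ≤ f k)
    (hf0 : f 0 = 0) (hren : ∀ n, 1 ≤ n → u n = ∑ k ∈ range (n + 1), f k * u (n - k)) : ∑' k, f k ≤ 1 :=
  Real.tsum_le_of_sum_range_le hf (sum_range_f_le_one hu0 hu hu1 hf hf0 hren)

/-- **Recurrence criterion** (the direction `Σ uₙ = ∞ ⇒ Σ fₖ = 1`): if the renewal sequence is not summable,
the first-occurrence weights sum to exactly `1`. [cite: Feller1968, XIII.3, Theorem 2] -/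
theorem hasSum_f_one (hu0 : u 0 = 1) (hu : ∀ n, 0 ≤ u n) (hu1 : ∀ n, u n ≤ 1) (hf : ∀ k, 0 ≤ f k)
    (hf0 : f 0 = 0) (hren : ∀ n, 1 ≤ n → u n = ∑ k ∈ range (n + 1), f k * u (n - k))
    (hdiv : ¬ Summable u) : HasSum f 1 := by
  have hfu : ∀ n, f n ≤ u n := f_le_u hu0 hu hf hf0 hren
  have hf1 : ∀ n, f n ≤ 1 := fun n => (hfu n).trans (hu1 n)
  have hsum : Summable f := summable_f hu0 hu hu1 hf hf0 hren
  have hle : ∑' k, f k ≤ 1 := tsum_f_le_one hu0 hu hu1 hf hf0 hren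
  suffices hge : 1 ≤ ∑' k, f k by
    exact hsum.hasSum_iff.mpr (le_antisymm hle hge)
  by_contra hlt
  rw [not_le] at hlt
  set σ : ℝ := ∑' k, f k with hσ
  have hσ1 : 0 < 1 - σ := by linarith
  -- `U(s) ≤ 1/(1 - σ)` on `[0,1)`, hence every partial sum of `u` is `≤ 1/(1-σ)`: `u` summable, contradiction
  apply hdiv
  refine summable_of_sum_range_le hu (c := (1 - σ)⁻¹) fun M => ?_
  have hcont : Tendsto (fun s : ℝ => ∑ n ∈ range M, u n * s ^ n) (𝓝[<] 1) (𝓝 (∑ n ∈ range M, u n)) := by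
    have : Continuous fun s : ℝ => ∑ n ∈ range M, u n * s ^ n := by fun_prop
    simpa using (this.tendsto 1).mono_left nhdsWithin_le_nhds
  refine le_of_tendsto hcont ?_
  have hmem : Set.Ioo (0 : ℝ) 1 ∈ 𝓝[<] (1 : ℝ) := Ioo_mem_nhdsLT (by norm_num)
  filter_upwards [hmem] with s hs
  have hU : Summable fun n => u n * s ^ n := summable_mul_pow hu hu1 hs.1.le hs.2
  have hF : Summable fun n => f n * s ^ n := summable_mul_pow hf hf1 hs.1.le hs.2
  obtain ⟨hFlt, hkey⟩ := genF_lt_one hu0 hu hu1 hf hf0 hren hs.1.le hs.2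
  -- `F(s) ≤ σ`
  have hFσ : (∑' k, f k * s ^ k) ≤ σ := by
    rw [hσ]
    refine Summable.tsum_le_tsum (fun n => ?_) hF hsum
    exact mul_le_of_le_one_right (hf n) (pow_le_one₀ hs.1.le hs.2.le)
  have hUle : (∑' n, u n * s ^ n) ≤ (1 - σ)⁻¹ := by
    rw [le_inv_comm₀ (by linarith [one_le_genU hu0 hu hu1 hs.1.le hs.2]) hσ1]
    -- `1 - σ ≤ 1 - F(s) = 1 / U(s)`
    have hUpos : 0 < (∑' n, u n * s ^ n) := by linarith [one_le_genU hu0 hu hu1 hs.1.le hs.2]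
    have : 1 - (∑' k, f k * s ^ k) = ((∑' n, u n * s ^ n))⁻¹ := by
      field_simp
      linear_combination hkey
    calc ((∑' n, u n * s ^ n))⁻¹ = 1 - (∑' k, f k * s ^ k) := this.symm
      _ ≥ 1 - σ := by linarith
  calc ∑ n ∈ range M, u n * s ^ n ≤ (∑' n, u n * s ^ n) :=
        hU.sum_le_tsum (range M) (fun n _ => mul_nonneg (hu n) (pow_nonneg hs.1.le n))
    _ ≤ (1 - σ)⁻¹ := hUle


/-! ### Null recurrence: `uₙ → 0` forces an infinite mean `Σ k fₖ = ∞` (Feller, XIII.3–4)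

For a RECURRENT renewal sequence (`Σ fₖ = 1`) with finite mean `μ = Σ k fₖ < ∞` one has `(1-s)U(s) ≥ 1/μ` on `[0,1)`
(because `1 - F(s) = Σ fₖ (1 - sᵏ) ≤ (1-s) μ`), while `uₙ → 0` gives `(1-s)U(s) → 0` (an Abelian bound); hence
`uₙ → 0` is only possible with `μ = ∞` (Feller XIII.4: the recurrent event is "null"; by the renewal theorem
`uₙ → 1/μ`, of which only this elementary half is needed and proved). -/

/-- **Null recurrence criterion.**  For a renewal sequence as above which is recurrent (`Σ fₖ = 1`): if `uₙ → 0` then the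
mean `Σ k fₖ` is infinite. [cite: Feller1968, XIII.3 (3.2) and XIII.4] -/
theorem not_summable_mul_of_tendsto_zero (hu0 : u 0 = 1) (hu : ∀ n, 0 ≤ u n) (hu1 : ∀ n, u n ≤ 1)
    (hf : ∀ k, 0 ≤ f k) (hf0 : f 0 = 0) (hren : ∀ n, 1 ≤ n → u n = ∑ k ∈ range (n + 1), f k * u (n - k))
    (hf1 : HasSum f 1) (hlim : Tendsto u atTop (𝓝 0)) : ¬ Summable fun k : ℕ => (k : ℝ) * f k := by
  intro hmean
  set μ : ℝ := ∑' k : ℕ, (k : ℝ) * f k with hμ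
  -- `μ ≥ 1 > 0`
  have hμ1 : 1 ≤ μ := by
    rw [hμ, ← hf1.tsum_eq]
    refine Summable.tsum_le_tsum (fun k => ?_) hf1.summable hmean
    rcases Nat.eq_zero_or_pos k with rfl | hk
    · simp [hf0]
    · have : (1 : ℝ) ≤ k := by exact_mod_cast hk
      nlinarith [hf k]
  have hμpos : 0 < μ := by linarith
  -- choose `ε = 1/(4μ)`, then `N` with `uₙ ≤ ε` for `n ≥ N`, then `s` with `(1 - s) N ≤ 1/(4μ)`
  set ε : ℝ := 1 / (4 * μ) with hε
  have hεpos : 0 < ε := by positivity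
  obtain ⟨N, hN⟩ : ∃ N, ∀ n ≥ N, u n ≤ ε := by
    have := (Metric.tendsto_atTop.1 hlim) ε hεpos
    obtain ⟨N, hN⟩ := this
    refine ⟨N, fun n hn => ?_⟩
    have h := hN n hn
    rw [Real.dist_eq, sub_zero, abs_of_nonneg (hu n)] at h
    exact h.le
  set s : ℝ := 1 - 1 / (4 * μ * (N + 1)) with hsdef
  have hden : 0 < 4 * μ * (N + 1) := by positivity
  have hs1 : s < 1 := by rw [hsdef]; have := one_div_pos.2 hden; linarith
  have hs0 : 0 ≤ s := by
    rw [hsdef, sub_nonneg, div_le_one hden]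
    have : (0 : ℝ) ≤ N := N.cast_nonneg
    nlinarith
  have h1s : 1 - s = 1 / (4 * μ * (N + 1)) := by rw [hsdef]; ring
  have h1spos : 0 < 1 - s := by linarith
  -- Bernoulli: `1 - sᵏ ≤ k (1 - s)`
  have bern : ∀ k : ℕ, 1 - s ^ k ≤ k * (1 - s) := fun k => by
    have h := one_add_mul_le_pow (a := s - 1) (by linarith) k
    have e : 1 + (s - 1) = s := by ring
    rw [e] at h
    linarith
  -- summability of the generating functions at `s`
  have hfu : ∀ n, f n ≤ u n := f_le_u hu0 hu hf hf0 hren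
  have hfle1 : ∀ n, f n ≤ 1 := fun n => (hfu n).trans (hu1 n)
  have hU : Summable fun n => u n * s ^ n := summable_mul_pow hu hu1 hs0 hs1
  have hF : Summable fun n => f n * s ^ n := summable_mul_pow hf hfle1 hs0 hs1
  obtain ⟨-, hkey⟩ := genF_lt_one hu0 hu hu1 hf hf0 hren hs0 hs1
  -- (a) `1 - F(s) ≤ (1 - s) μ`, hence `(1 - s) U(s) ≥ 1/μ`
  have hFbound : 1 - ∑' k, f k * s ^ k ≤ (1 - s) * μ := by
    have e1 : 1 - ∑' k, f k * s ^ k = ∑' k, f k * (1 - s ^ k) := by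
      have e0 : (1 : ℝ) - ∑' k, f k * s ^ k = ∑' k, f k - ∑' k, f k * s ^ k := by rw [hf1.tsum_eq]
      rw [e0, ← hf1.summable.tsum_sub hF]
      exact tsum_congr fun k => by ring
    have e2 : (1 - s) * μ = ∑' k : ℕ, (1 - s) * ((k : ℝ) * f k) := by rw [hμ, tsum_mul_left]
    rw [e1, e2]
    refine Summable.tsum_le_tsum (fun k => ?_) ?_ (hmean.mul_left _)
    · have := bern k
      nlinarith [hf k]
    · exact Summable.of_nonneg_of_le (fun k => mul_nonneg (hf k) (sub_nonneg.2 (pow_le_one₀ hs0 hs1.le)))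
        (fun k => by have := bern k; nlinarith [hf k]) (hmean.mul_left (1 - s))
  have hUlow : 1 / μ ≤ (1 - s) * ∑' n, u n * s ^ n := by
    -- from `U (1 - F) = 1` and `1 - F ≤ (1-s) μ`
    have hUnn : 0 ≤ ∑' n, u n * s ^ n := tsum_nonneg fun n => mul_nonneg (hu n) (pow_nonneg hs0 n)
    have : 1 ≤ (∑' n, u n * s ^ n) * ((1 - s) * μ) := by
      calc (1 : ℝ) = (∑' n, u n * s ^ n) * (1 - ∑' k, f k * s ^ k) := hkey.symm
        _ ≤ (∑' n, u n * s ^ n) * ((1 - s) * μ) := mul_le_mul_of_nonneg_left hFbound hUnn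
    rw [div_le_iff₀ hμpos]
    linarith
  -- (b) `U(s) ≤ N + ε/(1-s)`, hence `(1 - s) U(s) ≤ (1-s) N + ε ≤ 1/(2μ)`
  have hUup : ∑' n, u n * s ^ n ≤ N + ε / (1 - s) := by
    rw [← hU.sum_add_tsum_nat_add N]
    refine add_le_add ?_ ?_
    · calc ∑ n ∈ range N, u n * s ^ n ≤ ∑ n ∈ range N, (1 : ℝ) :=
            sum_le_sum fun n _ => by
              have := pow_le_one₀ (n := n) hs0 hs1.le
              nlinarith [hu n, hu1 n, pow_nonneg hs0 n]
        _ = N := by simp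
    · have hgeo : HasSum (fun n : ℕ => s ^ n) (1 - s)⁻¹ := hasSum_geometric_of_lt_one hs0 hs1
      have hg2 : Summable fun n : ℕ => ε * s ^ (n + N) := by
        have := (summable_nat_add_iff N).2 hgeo.summable
        exact this.mul_left ε
      calc ∑' n, u (n + N) * s ^ (n + N) ≤ ∑' n, ε * s ^ (n + N) := by
            refine Summable.tsum_le_tsum (fun n => ?_) ((summable_nat_add_iff N).2 hU) hg2
            exact mul_le_mul_of_nonneg_right (hN _ (by omega)) (pow_nonneg hs0 _)
        _ ≤ ∑' n, ε * s ^ n := by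
            refine Summable.tsum_le_tsum (fun n => ?_) hg2 (hgeo.summable.mul_left ε)
            exact mul_le_mul_of_nonneg_left (pow_le_pow_of_le_one hs0 hs1.le (by omega)) hεpos.le
        _ = ε / (1 - s) := by rw [tsum_mul_left, hgeo.tsum_eq, div_eq_mul_inv]
  have hcontra : (1 - s) * ∑' n, u n * s ^ n ≤ 1 / (2 * μ) := by
    have h2 : (1 - s) * (N + ε / (1 - s)) = (1 - s) * N + ε := by
      field_simp
    calc (1 - s) * ∑' n, u n * s ^ n ≤ (1 - s) * (N + ε / (1 - s)) :=
          mul_le_mul_of_nonneg_left hUup h1spos.le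
      _ = (1 - s) * N + ε := h2
      _ ≤ 1 / (4 * μ) + 1 / (4 * μ) := by
          refine add_le_add ?_ le_rfl
          rw [h1s, div_mul_eq_mul_div, one_mul, div_le_div_iff₀ hden (by positivity)]
          have : (0 : ℝ) ≤ N := N.cast_nonneg
          nlinarith
      _ = 1 / (2 * μ) := by field_simp; ring
  have : 1 / μ ≤ 1 / (2 * μ) := hUlow.trans hcontra
  rw [div_le_div_iff₀ hμpos (by positivity)] at this
  nlinarith

end Literature.Probability.Process.Renewal

end
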